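import Mathlib.LinearAlgebra.BilinearForm.Properties
import Mathlib.Algebra.Group.Subgroup.Map
import Literature.AlgebraicGeometry.HodgeTheory.SkewVanishingLattice
import Mathlib.LinearAlgebra.Span.Basic
import Mathlib.RingTheory.Finiteness.Basic
import Mathlib.RingTheory.Noetherian.Basic
import Mathlib.RingTheory.PrincipalIdealDomain
import Literature.AlgebraicGeometry.HodgeTheory.LocallyTrivialExtensionClasses
import Mathlib.GroupTheory.Index
import Mathlib.Logic.Relation
import Mathlib.Tactic.Module
import Mathlib.RingTheory.Coprime.Basic
import Mathlib.Algebra.Group.Int.Units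
import Mathlib.Algebra.Ring.Int.Parity
import Mathlib.Tactic.Ring
import Mathlib.Algebra.BigOperators.Associated
import Mathlib.Data.Nat.PrimeFin
import Mathlib.RingTheory.Int.Basic
import Mathlib.Tactic.LinearCombination
import HarnessLib

/-!
# Skew-symmetric vanishing lattices, I: transvection calculus (towards Janssen's Theorem 2.9)

W. Janssen, *Skew-symmetric vanishing lattices and their monodromy groups*, Math. Ann. 266 (1983), §2; C. Schnell,
*Primitive cohomology and the tube mapping*, Math. Z. 268 (2010), §7.  A skew(-symmetric) vanishing lattice
(`HodgeTheory.IsSkewVanishingLattice`, file `HodgeTheory/SkewVanishingLattice`) is a set `Δ` of vectors of a `ℚ`-space `V` with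
an alternating form `B` such that `ℤΔ` is finitely generated, `B` is integral on `Δ`, every Picard–Lefschetz transvection
`T_δ(x) = x - B(x, δ)δ`, `δ ∈ Δ`, lies in the monodromy group `Γ_Δ = ⟨T_δ : δ ∈ Δ⟩` (`transvectionGroup`), `Δ` is a single
`Γ_Δ`-orbit, and some pair has `B(δ₁, δ₂) = 1`.  This file collects the elementary calculus used in the proof of Janssen's
Theorem 2.9 (file `HodgeTheory/SkewVanishingLatticeJanssenTheorem`):

* Parts 1–4: a map given by the transvection formula is an isometry (`isometry_of_transvection_formula`); the inverse
  transvection `T_δ⁻¹(x) = x + B(x, δ)δ` (`inv_transvection_formula`); integrality of `B(·, z)` propagates to the `ℤ`-span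
  (`exists_int_eq_of_mem_span_int`); units of `End V` acting (`unit_inv_apply`, `units_apply_inv_apply`,
  `units_inv_apply_apply`); every element of `Γ_Δ` is an isometry and maps `ℤΔ` into itself (`transvectionGroup_isometry`,
  `transvectionGroup_map_span_int`);
* Part 5 — plane calculus of the square move `T_a²(x) = x - 2B(x, a)a` (`skewTransvection_sq_apply`), the involution
  `-1` on a hyperbolic plane (`negOnPlane`), powers and inverses of square moves (`sqMove_pow_apply`, `sqMove_inv_apply`,
  `sqMove_inv_pow_apply`) and the packaged `planeCalculus`;
* Parts 6–7 — pure arithmetic: the Euclid game on pairs `(A, β)`, `A` odd, `β` coprime to `A`, under the moves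
  `(A, β) ↦ (A, β + kA)`, `(A, β) ↦ (A + 4kβ, β)` (`euclidGame`), and the coprime shift `A + s·2j` coprime to `β`
  (`coprimeShift`).

Theorems only: no definition, no named fact.

Provenance: Literature home (namespace `Literature.AlgebraicGeometry.HodgeTheory.VanishingLattice`; the Summits prefix
`localTubeSpan_` of every name is dropped) of the declarations used by Janssen's Theorem 2.9 from the Summits-side
`HodgeConjecture/Theorems/LinearSystemTorelliLocalTubeSpan{Transvections, Saturation, OrbitSpan, FrameLiftBasic, PlaneCalculus,
EuclidGame, CoprimeShift}` (route `LinearSystemTorelli`, crux `LocalTubeSpan`; imports Mathlib and `Literature/` only), which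
`Literature/` may not import. Lane `lit-hodgefound`, seat p20.

## References

* [Janssen1983] W. A. M. Janssen, *Skew-symmetric vanishing lattices and their monodromy groups*, Math. Ann. 266 (1983)
  115–133, §2 (Thm. 2.5, Lemma 2.7, Thm. 2.9).
* [Schnell2010] C. Schnell, *Primitive cohomology and the tube mapping*, Math. Z. 268 (2010), §7 (Lemma 11 and its proof).
* [Baraglia2017] D. Baraglia, *Monodromy of the SL(n) and GL(n) Hitchin fibrations*, Math. Ann. 370 (2018), Lemma 6.2
  (quotation of Janssen's Thm. 2.9).
-/

noncomputable section

namespace Literature.AlgebraicGeometry.HodgeTheory.VanishingLattice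

/-! ## Part 1: Isometry from the transvection formula -/

section Part1

open Literature.AlgebraicGeometry.HodgeTheory

/-! ### Transvection calculus -/

section Calculus

variable {K V : Type*} [CommRing K] [AddCommGroup V] [Module K V] (B : LinearMap.BilinForm K V)

/-- A Picard–Lefschetz transvection `T(x) = x - B(x, δ) δ` of an ALTERNATING form is an isometry:
`B(Tx, Ty) = B(x, y) - B(x, δ)(B(y, δ) + B(δ, y)) + B(x, δ)B(y, δ)B(δ, δ) = B(x, y)`. [cite: Janssen1983, §2 (proof of Thm. 2.9)] -/
theorem isometry_of_transvection_formula (hB : B.IsAlt) (δ : V) (T : V →ₗ[K] V)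
    (hT : ∀ x, T x = x - B x δ • δ) (x y : V) : B (T x) (T y) = B x y := by
  have h1 : B δ δ = 0 := hB.self_eq_zero δ
  have h2 : B δ y = -B y δ := (hB.neg_eq y δ).symm
  rw [hT x, hT y]
  simp only [map_sub, map_smul, LinearMap.sub_apply, LinearMap.smul_apply, smul_eq_mul, h1, h2]
  ring

variable {G : Type*} [Group G] (ρ : G →* (V →ₗ[K] V))

end Calculus

/-! ### The image of the group in `GL`: generators ↦ transvections -/

section Image

variable {G : Type*} [Group G] {W : Type*} [AddCommGroup W] [Module ℚ W]

end Image

end Part1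

/-! ## Part 2: Inverse transvections; integrality on the ℤ-span -/

section Part2

open _root_.CategoryTheory groupCohomology
open Literature.AlgebraicGeometry.HodgeTheory

/-! ### Transvection groups generated by finitely many meridians -/

section Generators

variable {G : Type*} [Group G] {V : Type*} [AddCommGroup V] [Module ℚ V]
  (ρ : G →* (V →ₗ[ℚ] V)) (B : LinearMap.BilinForm ℚ V)

/-- The inverse of a Picard–Lefschetz transvection `T_δ(x) = x - B(x, δ)δ` of an alternating form is
`T_δ⁻¹(x) = x + B(x, δ)δ`. [cite: Janssen1983, §2 (proof of Thm. 2.9)] -/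
theorem inv_transvection_formula (hB : B.IsAlt) (t : G) (δ : V)
    (ht : ∀ x, ρ t x = x - B x δ • δ) (x : V) : ρ t⁻¹ x = x + B x δ • δ := by
  have h1 : ρ t (x + B x δ • δ) = x := by
    rw [ht]
    simp only [map_add, map_smul, LinearMap.add_apply, LinearMap.smul_apply, smul_eq_mul,
      hB.self_eq_zero, mul_zero, add_zero, add_sub_cancel_right]
  calc ρ t⁻¹ x = ρ t⁻¹ (ρ t (x + B x δ • δ)) := by rw [h1]
    _ = x + B x δ • δ := by
        rw [← Module.End.mul_apply, ← map_mul, inv_mul_cancel, map_one, Module.End.one_apply]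

/-- Integrality of `B(·, z)` propagates from a set to its `ℤ`-span. [cite: Janssen1983, §2 (proof of Thm. 2.9)] -/
theorem exists_int_eq_of_mem_span_int (S : Set V) (z : V)
    (hS : ∀ y ∈ S, ∃ n : ℤ, B y z = n) {y : V} (hy : y ∈ Submodule.span ℤ S) :
    ∃ n : ℤ, B y z = n := by
  induction hy using Submodule.span_induction with
  | mem y hy => exact hS y hy
  | zero => exact ⟨0, by rw [map_zero, LinearMap.zero_apply, Int.cast_zero]⟩
  | add y y' _ _ hy hy' =>
      obtain ⟨n, hn⟩ := hy
      obtain ⟨n', hn'⟩ := hy'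
      exact ⟨n + n', by rw [map_add, LinearMap.add_apply, hn, hn', Int.cast_add]⟩
  | smul n y _ hy =>
      obtain ⟨m, hm⟩ := hy
      refine ⟨n * m, ?_⟩
      rw [← Int.cast_smul_eq_zsmul ℚ n y, map_smul, LinearMap.smul_apply, hm, smul_eq_mul,
        Int.cast_mul]

end Generators

/-! ### The orbit-saturation of finite integral data -/

section Saturation

variable {G : Type} [Group G] (A : Rep.{0} ℚ G)

end Saturation

end Part2

/-! ## Part 3: Units acting: `g⁻¹ (g x) = x` -/

section Part3

open Literature.AlgebraicGeometry.HodgeTheory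

/-! ### Powers and inverses of transvection units -/

section Units

variable {K V : Type*} [CommRing K] [AddCommGroup V] [Module K V] (B : LinearMap.BilinForm K V)

/-- The inverse of a unit of `End V` acting as the transvection `T_δ(x) = x - B(x, δ)δ` with
`B(δ, δ) = 0` acts as `x ↦ x + B(x, δ)δ`. [cite: Janssen1983, §2 (proof of Thm. 2.9)] -/
theorem unit_inv_apply {u : (V →ₗ[K] V)ˣ} {δ : V}
    (hu : (u : V →ₗ[K] V) = skewTransvection B δ) (hδδ : B δ δ = 0) (x : V) :
    ((u⁻¹ : (V →ₗ[K] V)ˣ) : V →ₗ[K] V) x = x + B x δ • δ := by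
  have h1 : (u : V →ₗ[K] V) (x + B x δ • δ) = x := by
    rw [hu]
    exact skewTransvection_apply_add B hδδ x
  calc ((u⁻¹ : (V →ₗ[K] V)ˣ) : V →ₗ[K] V) x
        = ((u⁻¹ : (V →ₗ[K] V)ˣ) : V →ₗ[K] V) ((u : V →ₗ[K] V) (x + B x δ • δ)) := by rw [h1]
    _ = x + B x δ • δ := by rw [← Module.End.mul_apply, Units.inv_mul, Module.End.one_apply]

end Units

/-! ### The non-orthogonality graph of a vanishing lattice is connected -/

section Reach

variable {V : Type*} [AddCommGroup V] [Module ℚ V] (B : LinearMap.BilinForm ℚ V)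

end Reach

/-! ### The orbit of a finite-index subgroup spans -/

section OrbitSpan

end OrbitSpan

end Part3

/-! ## Part 4: Transvection groups: isometry and stability of `ℤΔ` -/

section Part4

open Literature.AlgebraicGeometry.HodgeTheory

/-! ### Elements of a transvection group: radical, isometry, lattice, span -/

section Basic

variable {V : Type*} [AddCommGroup V] [Module ℚ V] (B : LinearMap.BilinForm ℚ V)

/-- `a (a⁻¹ x) = x` for a unit of `End V`. [cite: Janssen1983, §2 (proof of Thm. 2.9)] -/
theorem units_apply_inv_apply (a : (V →ₗ[ℚ] V)ˣ) (x : V) :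
    (a : V →ₗ[ℚ] V) (((a⁻¹ : (V →ₗ[ℚ] V)ˣ) : V →ₗ[ℚ] V) x) = x := by
  rw [← Module.End.mul_apply, ← Units.val_mul, mul_inv_cancel, Units.val_one, Module.End.one_apply]

/-- `a⁻¹ (a x) = x` for a unit of `End V`. [cite: Janssen1983, §2 (proof of Thm. 2.9)] -/
theorem units_inv_apply_apply (a : (V →ₗ[ℚ] V)ˣ) (x : V) :
    ((a⁻¹ : (V →ₗ[ℚ] V)ˣ) : V →ₗ[ℚ] V) ((a : V →ₗ[ℚ] V) x) = x := by
  rw [← Module.End.mul_apply, ← Units.val_mul, inv_mul_cancel, Units.val_one, Module.End.one_apply]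

/-- Every element of `Γ_S` is an isometry of the alternating form `B`. [cite: Janssen1983, §2 (proof of Thm. 2.9)] -/
theorem transvectionGroup_isometry (hB : B.IsAlt) (S : Set V)
    {g : (V →ₗ[ℚ] V)ˣ} (hg : g ∈ transvectionGroup B S) (x y : V) :
    B ((g : V →ₗ[ℚ] V) x) ((g : V →ₗ[ℚ] V) y) = B x y := by
  unfold transvectionGroup at hg
  induction hg using Subgroup.closure_induction'' generalizing x y with
  | mem u hu =>
    obtain ⟨δ, -, hu⟩ := hu
    refine isometry_of_transvection_formula B hB δ _ (fun z => ?_) x y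
    rw [hu, skewTransvection_apply]
  | inv_mem u hu =>
    obtain ⟨δ, -, hu⟩ := hu
    have hisou : ∀ a b, B ((u : V →ₗ[ℚ] V) a) ((u : V →ₗ[ℚ] V) b) = B a b := fun a b =>
      isometry_of_transvection_formula B hB δ _
        (fun z => by rw [hu, skewTransvection_apply]) a b
    rw [← hisou, units_apply_inv_apply, units_apply_inv_apply]
  | one => rw [Units.val_one, Module.End.one_apply, Module.End.one_apply]
  | mul g h _ _ ihg ihh => rw [Units.val_mul, Module.End.mul_apply, Module.End.mul_apply, ihg, ihh]

/-- Every element of `Γ_Δ` preserves the lattice `ℤΔ` when `B` is integral on `Δ`. [cite: Janssen1983, §2 (proof of Thm. 2.9)] -/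
theorem transvectionGroup_map_span_int (hB : B.IsAlt) (Δ : Set V)
    (hint : ∀ δ ∈ Δ, ∀ δ' ∈ Δ, ∃ n : ℤ, B δ δ' = n)
    {g : (V →ₗ[ℚ] V)ˣ} (hg : g ∈ transvectionGroup B Δ) {x : V}
    (hx : x ∈ Submodule.span ℤ Δ) : (g : V →ₗ[ℚ] V) x ∈ Submodule.span ℤ Δ := by
  unfold transvectionGroup at hg
  induction hg using Subgroup.closure_induction'' generalizing x with
  | mem u hu =>
    obtain ⟨δ, hδ, hu⟩ := hu
    obtain ⟨n, hn⟩ := exists_int_eq_of_mem_span_int B Δ δ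
      (fun y hy => hint y hy δ hδ) hx
    rw [hu, skewTransvection_apply, hn, Int.cast_smul_eq_zsmul]
    exact Submodule.sub_mem _ hx (Submodule.smul_mem _ _ (Submodule.subset_span hδ))
  | inv_mem u hu =>
    obtain ⟨δ, hδ, hu⟩ := hu
    obtain ⟨n, hn⟩ := exists_int_eq_of_mem_span_int B Δ δ
      (fun y hy => hint y hy δ hδ) hx
    rw [unit_inv_apply B hu (hB.self_eq_zero δ), hn, Int.cast_smul_eq_zsmul]
    exact Submodule.add_mem _ hx (Submodule.smul_mem _ _ (Submodule.subset_span hδ))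
  | one => rwa [Units.val_one, Module.End.one_apply]
  | mul g h _ _ ihg ihh =>
    rw [Units.val_mul, Module.End.mul_apply]
    exact ihg (ihh hx)

end Basic

end Part4

/-! ## Part 5: Plane calculus of the square move `T_a²` -/

section Part5

open Literature.AlgebraicGeometry.HodgeTheory

/-! ### Squared transvections of an alternating form -/

section PlaneCalculus

variable {V : Type} [AddCommGroup V] [Module ℚ V]

/-- The square of a transvection of an alternating form: `T_a (T_a u) = u - 2 B(u, a) a`
(`B(a, a) = 0`). [cite: Janssen1983, §2 (proof of Thm. 2.9)] -/
theorem skewTransvection_sq_apply (B : LinearMap.BilinForm ℚ V) (hB : B.IsAlt)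
    (a u : V) :
    skewTransvection B a (skewTransvection B a u) = u - (2 : ℚ) • (B u a • a) := by
  rw [skewTransvection_apply, skewTransvection_apply, map_sub, map_smul, LinearMap.sub_apply,
    LinearMap.smul_apply, hB.self_eq_zero a, smul_eq_mul, mul_zero, sub_zero]
  module

/-- **The word `T_x² T_y² T_{x+y}²` is `-1` on a unimodular plane.** For an alternating form `B`
and `B(x, y) = 1`, the product of the squared transvections along `x`, `y`, `x + y` acts as
`v ↦ v - 2 (B(v, y) x - B(v, x) y)`: it is `-1` on `ℚx ⊕ ℚy` (`x ↦ -x`, `y ↦ -y`) and the identity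
on the `B`-orthogonal of the plane. [cite: Janssen1983, §2 (proof of Thm. 2.9)] -/
theorem negOnPlane (B : LinearMap.BilinForm ℚ V) (hB : B.IsAlt) {x y : V}
    (hxy : B x y = 1) (v : V) :
    skewTransvection B x (skewTransvection B x (skewTransvection B y (skewTransvection B y
      (skewTransvection B (x + y) (skewTransvection B (x + y) v))))) =
      v - (2 : ℚ) • (B v y • x - B v x • y) := by
  have hxx : B x x = 0 := hB.self_eq_zero x
  have hyy : B y y = 0 := hB.self_eq_zero y
  have hyx : B y x = -1 := by rw [← hB.neg_eq, hxy]
  simp only [skewTransvection_sq_apply B hB, map_sub, map_smul, map_add, hxy, hyx,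
    hxx, hyy]
  module

/-- Powers of a unit `g` of `End V` acting as a squared transvection `T_a²`, `v ↦ v - 2 B(v, a) a`,
of an alternating form: `gᵐ v = v - 2m B(v, a) a`. [cite: Janssen1983, §2 (proof of Thm. 2.9)] -/
theorem sqMove_pow_apply (B : LinearMap.BilinForm ℚ V) (hB : B.IsAlt) (a : V)
    (g : (V →ₗ[ℚ] V)ˣ) (hg : ∀ v, (g : V →ₗ[ℚ] V) v = v - (2 : ℚ) • (B v a • a)) (m : ℕ) (v : V) :
    ((g ^ m : (V →ₗ[ℚ] V)ˣ) : V →ₗ[ℚ] V) v = v - (2 * m : ℚ) • (B v a • a) := by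
  induction m with
  | zero =>
    rw [pow_zero, Units.val_one, Module.End.one_apply, Nat.cast_zero, mul_zero, zero_smul,
      sub_zero]
  | succ n ih =>
    rw [pow_succ', Units.val_mul, Module.End.mul_apply, ih, hg]
    simp only [map_sub, map_smul, LinearMap.sub_apply, LinearMap.smul_apply, smul_eq_mul,
      hB.self_eq_zero a, mul_zero, sub_zero, Nat.cast_succ]
    module

/-- The inverse of a unit `g` of `End V` acting as a squared transvection `T_a²`,
`v ↦ v - 2 B(v, a) a`, of an alternating form acts as `v ↦ v + 2 B(v, a) a`. [cite: Janssen1983, §2 (proof of Thm. 2.9)] -/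
theorem sqMove_inv_apply (B : LinearMap.BilinForm ℚ V) (hB : B.IsAlt) (a : V)
    (g : (V →ₗ[ℚ] V)ˣ) (hg : ∀ v, (g : V →ₗ[ℚ] V) v = v - (2 : ℚ) • (B v a • a)) (v : V) :
    ((g⁻¹ : (V →ₗ[ℚ] V)ˣ) : V →ₗ[ℚ] V) v = v + (2 : ℚ) • (B v a • a) := by
  have h1 : (g : V →ₗ[ℚ] V) (v + (2 : ℚ) • (B v a • a)) = v := by
    rw [hg]
    simp only [map_add, map_smul, LinearMap.add_apply, LinearMap.smul_apply, smul_eq_mul,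
      hB.self_eq_zero a, mul_zero, add_zero, add_sub_cancel_right]
  calc ((g⁻¹ : (V →ₗ[ℚ] V)ˣ) : V →ₗ[ℚ] V) v
      = ((g⁻¹ : (V →ₗ[ℚ] V)ˣ) : V →ₗ[ℚ] V) ((g : V →ₗ[ℚ] V) (v + (2 : ℚ) • (B v a • a))) := by
        rw [h1]
    _ = v + (2 : ℚ) • (B v a • a) := units_inv_apply_apply g _

/-- Negative powers of a unit `g` of `End V` acting as a squared transvection `T_a²`,
`v ↦ v - 2 B(v, a) a`, of an alternating form: `g⁻ᵐ v = v + 2m B(v, a) a`. [cite: Janssen1983, §2 (proof of Thm. 2.9)] -/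
theorem sqMove_inv_pow_apply (B : LinearMap.BilinForm ℚ V) (hB : B.IsAlt) (a : V)
    (g : (V →ₗ[ℚ] V)ˣ) (hg : ∀ v, (g : V →ₗ[ℚ] V) v = v - (2 : ℚ) • (B v a • a)) (m : ℕ) (v : V) :
    ((g⁻¹ ^ m : (V →ₗ[ℚ] V)ˣ) : V →ₗ[ℚ] V) v = v + (2 * m : ℚ) • (B v a • a) := by
  induction m with
  | zero =>
    rw [pow_zero, Units.val_one, Module.End.one_apply, Nat.cast_zero, mul_zero, zero_smul,
      add_zero]
  | succ n ih =>
    rw [pow_succ', Units.val_mul, Module.End.mul_apply, ih, sqMove_inv_apply B hB a g hg]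
    simp only [map_add, map_smul, LinearMap.add_apply, LinearMap.smul_apply, smul_eq_mul,
      hB.self_eq_zero a, mul_zero, add_zero, Nat.cast_succ]
    module

/-- **Plane calculus of squared transvections** (alternating `B`): (i) for a unimodular pair
`B(x, y) = 1` the word `T_x² T_y² T_{x+y}²` acts as `v ↦ v - 2 (B(v, y) x - B(v, x) y)` (`-1` on
the plane `ℚx ⊕ ℚy`, the identity on its orthogonal); (ii) a unit `g` of `End V` acting as `T_a²`,
`v ↦ v - 2 B(v, a) a`, has `gᵐ v = v - 2m B(v, a) a` and `g⁻ᵐ v = v + 2m B(v, a) a`. [cite: Janssen1983, §2 (proof of Thm. 2.9)] -/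
theorem planeCalculus (B : LinearMap.BilinForm ℚ V) (hB : B.IsAlt) :
    (∀ x y : V, B x y = 1 → ∀ v : V,
      skewTransvection B x (skewTransvection B x (skewTransvection B y (skewTransvection B y
        (skewTransvection B (x + y) (skewTransvection B (x + y) v))))) =
        v - (2 : ℚ) • (B v y • x - B v x • y)) ∧
    (∀ (a : V) (g : (V →ₗ[ℚ] V)ˣ),
      (∀ v, ((g : (V →ₗ[ℚ] V)ˣ) : V →ₗ[ℚ] V) v = v - (2 : ℚ) • (B v a • a)) →
      ∀ (m : ℕ) (v : V),
        (((g ^ m : (V →ₗ[ℚ] V)ˣ)) : V →ₗ[ℚ] V) v = v - (2 * m : ℚ) • (B v a • a) ∧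
        (((g⁻¹ ^ m : (V →ₗ[ℚ] V)ˣ)) : V →ₗ[ℚ] V) v = v + (2 * m : ℚ) • (B v a • a)) :=
  ⟨fun _ _ hxy v => negOnPlane B hB hxy v, fun a g hg m v =>
    ⟨sqMove_pow_apply B hB a g hg m v,
      sqMove_inv_pow_apply B hB a g hg m v⟩⟩

end PlaneCalculus

end Part5

/-! ## Part 6: The Euclid game on coprime pairs -/

section Part6

/-- **The Euclid game** (pure arithmetic).
Let `P` be a predicate on pairs of integers which is stable under the two elementary moves
`(A, β) ↦ (A, β + k A)` and `(A, β) ↦ (A + 4 k β, β)` (`k ∈ ℤ`) and holds at `(1, 0)` and at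
`(-1, 0)`.  Then `P A β` holds for every odd `A` and every `β` coprime to `A`: a Euclidean descent
on `|A| + |β|` — for `β ≠ 0` one has `|A| ≠ 2|β|` by parity, and `A ↦ A ∓ 4β` (if `|A| > 2|β|`)
or `β ↦ β ∓ A` (if `|A| < 2|β|`) strictly decreases `|A| + |β|` while preserving coprimality and
the parity of `A`; for `β = 0` coprimality forces `A = ±1`. [cite: Janssen1983, §2 (proof of Thm. 2.9)] -/
theorem euclidGame (P : ℤ → ℤ → Prop)
    (h1 : ∀ A β k : ℤ, P A β → P A (β + k * A))
    (h2 : ∀ A β k : ℤ, P A β → P (A + 4 * k * β) β)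
    (hone : P 1 0) (hneg : P (-1) 0)
    (A β : ℤ) (hA : Odd A) (hcop : IsCoprime A β) : P A β := by
  -- Euclidean descent on `|A| + |β|`
  obtain ⟨n, hn⟩ : ∃ n : ℕ, A.natAbs + β.natAbs ≤ n := ⟨_, le_rfl⟩
  induction n generalizing A β with
  | zero =>
    -- `|A| + |β| = 0` forces `A = 0`, which is not odd
    have hA2 : A % 2 = 1 := Int.odd_iff.mp hA
    omega
  | succ n ih =>
    by_cases hβ : β = 0
    · -- `gcd(A, 0) = 1` forces `A = ±1`
      subst hβ
      rcases Int.isUnit_iff.mp (isCoprime_zero_right.mp hcop) with rfl | rfl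
      exacts [hone, hneg]
    · have hA2 : A % 2 = 1 := Int.odd_iff.mp hA
      -- one elementary move (with `k = ±1`) strictly decreases `|A| + |β|`
      have hmove : (∃ k : ℤ, (A + 4 * k * β).natAbs < A.natAbs) ∨
          (∃ k : ℤ, (β + k * A).natAbs < β.natAbs) := by
        rcases le_or_gt 0 A with hA0 | hA0 <;> rcases le_or_gt 0 β with hb0 | hb0 <;>
          rcases lt_or_ge (2 * β.natAbs) A.natAbs with hc | hc
        exacts [Or.inl ⟨-1, by omega⟩, Or.inr ⟨-1, by omega⟩, Or.inl ⟨1, by omega⟩,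
          Or.inr ⟨1, by omega⟩, Or.inl ⟨1, by omega⟩, Or.inr ⟨1, by omega⟩,
          Or.inl ⟨-1, by omega⟩, Or.inr ⟨-1, by omega⟩]
      rcases hmove with ⟨k, hk⟩ | ⟨k, hk⟩
      · -- move `A ↦ A + 4kβ`, apply the induction hypothesis, and move back with `-k`
        have hP : P (A + 4 * k * β) β :=
          ih (A + 4 * k * β) β (hA.add_even ⟨2 * k * β, by ring⟩)
            (hcop.add_mul_right_left (4 * k)) (by omega)
        have e : A + 4 * k * β + 4 * (-k) * β = A := by ring
        have hP' := h2 _ _ (-k) hP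
        rwa [e] at hP'
      · -- move `β ↦ β + kA`, apply the induction hypothesis, and move back with `-k`
        have hP : P A (β + k * A) :=
          ih A (β + k * A) hA (hcop.add_mul_right_right k) (by omega)
        have e : β + k * A + (-k) * A = β := by ring
        have hP' := h1 _ _ (-k) hP
        rwa [e] at hP'

end Part6

/-! ## Part 7: Coprime shifts -/

section Part7

/-- **Coprime shift** (pure arithmetic).  If `A` is
odd, `U * A + 2 * W * β + j = 1`, `β ≠ 0` and `j ≠ 0`, then `A + s * (2 * j)` is coprime to `β`
for some integer `s`, namely `s = ∏ p` over the prime factors `p` of `2jβ` (the determinant of the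
primitive matrix `(A β; 2j 0)`, up to sign) not dividing `A`: no prime divides `A`, `β` and `2j`
(it would divide `2 * (U * A + 2 * W * β + j) = 2` and, `A` being odd, `1`), and a common prime
of `A + 2sj` and `β` dividing `A` (resp. not dividing `A`) does not (resp. does) divide `s`,
whence it divides `2j` (resp. `A`) — impossible either way. [cite: Janssen1983, §2 (proof of Thm. 2.9)] -/
theorem coprimeShift (A β j U W : ℤ) (hA : Odd A) (hrel : U * A + 2 * W * β + j = 1)
    (hβ : β ≠ 0) (hj : j ≠ 0) :
    ∃ s : ℤ, IsCoprime (A + s * (2 * j)) β := by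
  classical
  -- adapted from the tree's Literature lemma (file `HeckeOperatorsDoubleCoset.lean`)
  -- `Literature.NumberTheory.EllipticCurves.ModularForms.HeckeTComm.exists_isCoprime_add_mul`,
  -- case `(a b; c d) = (A β; 2j 0)`.
  -- Step 1 (primitivity): no prime divides `A`, `β` and `2 * j`.
  have hprim : ∀ p : ℕ, p.Prime → (p : ℤ) ∣ A → (p : ℤ) ∣ β → ¬ (p : ℤ) ∣ 2 * j := by
    intro p hp hpA hpβ hp2j
    have hpZ : Prime (p : ℤ) := Nat.prime_iff_prime_int.mp hp
    have h2 : (p : ℤ) ∣ 2 := by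
      have h : (2 : ℤ) = 2 * U * A + 2 * (2 * W) * β + 2 * j := by
        linear_combination (-2 : ℤ) * hrel
      rw [h]
      exact dvd_add (dvd_add (hpA.mul_left _) (hpβ.mul_left _)) hp2j
    obtain ⟨k, hk⟩ := hA
    have h1 : (1 : ℤ) = A - 2 * k := by rw [hk]; ring
    exact hpZ.not_dvd_one (h1 ▸ dvd_sub hpA (h2.mul_right k))
  -- Step 2: the shift `s = ∏ p` over the prime factors `p` of the determinant `2jβ ≠ 0` not
  -- dividing `A`.
  have hdet : 2 * j * β ≠ 0 := mul_ne_zero (mul_ne_zero two_ne_zero hj) hβ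
  set T : Finset ℕ := (2 * j * β).natAbs.primeFactors.filter (fun p : ℕ ↦ ¬ (p : ℤ) ∣ A)
  set s : ℤ := ∏ p ∈ T, (p : ℤ) with hs
  refine ⟨s, Int.isCoprime_iff_nat_coprime.mpr (Nat.coprime_of_dvd fun p hp hpa hpb ↦ ?_)⟩
  rw [← Int.natCast_dvd] at hpa hpb
  have hpZ : Prime (p : ℤ) := Nat.prime_iff_prime_int.mp hp
  by_cases hpA : (p : ℤ) ∣ A
  · -- `p ∉ T`, hence `p ∤ s`, hence `p ∣ 2 * j`: excluded by Step 1
    have hps : ¬ (p : ℤ) ∣ s := by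
      intro h
      rw [hs, hpZ.dvd_finsetProd_iff] at h
      obtain ⟨q, hqT, hpq⟩ := h
      rw [Int.natCast_dvd_natCast] at hpq
      obtain ⟨hq, hqA⟩ := Finset.mem_filter.mp hqT
      obtain rfl : p = q :=
        (Nat.prime_dvd_prime_iff_eq hp (Nat.prime_of_mem_primeFactors hq)).mp hpq
      exact hqA hpA
    have h2j : (p : ℤ) ∣ s * (2 * j) := by
      have := dvd_sub hpa hpA
      rwa [add_sub_cancel_left] at this
    exact hprim p hp hpA hpb ((hpZ.dvd_or_dvd h2j).resolve_left hps)
  · -- `p ∣ β ∣ 2jβ` and `p ∤ A`: `p ∈ T`, hence `p ∣ s`, hence `p ∣ A` after all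
    have hpT : p ∈ T :=
      Finset.mem_filter.mpr ⟨Nat.mem_primeFactors.mpr
        ⟨hp, Int.natCast_dvd.mp (hpb.mul_left (2 * j)), Int.natAbs_ne_zero.mpr hdet⟩, hpA⟩
    have hps : (p : ℤ) ∣ s := Finset.dvd_prod_of_mem _ hpT
    refine hpA ?_
    have := dvd_sub hpa (dvd_mul_of_dvd_left hps (2 * j))
    rwa [add_sub_cancel_right] at this

end Part7

end Literature.AlgebraicGeometry.HodgeTheory.VanishingLattice

end
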